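import Literature.AlgebraicGeometry.Frobenioids.ArchimedeanIsoSubanchors
import Literature.AlgebraicGeometry.Frobenioids.ArchimedeanBasicProperties
import Literature.AlgebraicGeometry.Frobenioids.ArchimedeanUnitMonoids
import Literature.AlgebraicGeometry.Frobenioids.AngularFrobenioidsRelative
import Literature.AlgebraicGeometry.Frobenioids.ArchimedeanBaseComparison
import Literature.AlgebraicGeometry.Frobenioids.ModelFrobenioidFunctor
import HarnessLib

/-!
# Frobenioids II, Proposition 3.5 / Theorem 3.6 / Remark 3.6.1 — the printed claims, i.e. the generic
# predicates of `ArchimedeanIsoSubanchors.lean` / `ArchimedeanBasicProperties.lean` evaluated at the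
# categories of Example 3.3

Mochizuki, *The geometry of Frobenioids II*, Kyushu J. Math. **62** (2008) 401–460, §3, Prop. 3.5
pp. 34–36, Thm. 3.6 pp. 36–39, Rmk. 3.6.1 p. 39 [cite: MochizukiFrdII2008, Thm 3.6 pp.36-38].

The objects of Example 3.3 over a base `π : D → D₀` are those of `AngularFrobenioidsRelative.lean`
(seat abc-iut-L1-t6): the archimedean Frobenioid `C π = C₀ ×_{D₀} D` with structure functor
`C.toElem π : C π → F_{Φ π}`; `C^Λ` for `Λ ∈ {ℤ, ℚ, ℝ}` as `archFrobenioid π pf rlf Λ : LambdaCompletion π`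
(the perfection / realification data `pf`, `rlf` are that file's INTERFACE until [FrdI] Def. 3.1 (iii) /
Prop. 5.3 are constructed; `Λ = ℤ` is `C π` itself); the angular Frobenioid `A π` (isometries) with its
OWN structure `A.toElem π` over the zero divisor monoid ("of group-like type"); the angloids `N π`, `R π`
with their functors `N.toC π`, `R.toC π` to `C π` (Frobenioid-theoretic words for `N`, `R` refer to
images in `C`, Ex. 3.3 (iv) p. 29). The base `D → D₀` is read in t4's non-skeletal `D₀ = ArchBase`
([FrdII] Def. 3.1 (v), `RC.*`) through the comparison functor `ArchFrd.D0.toArchBase`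
(`ArchimedeanBaseComparison.lean`, seat abc-iut-L1-t6): `baseRC π = π ⋙ D0.toArchBase`.

The extra structure some items speak about is supplied here from the construction: the ambient space
`V_A^× = ℂ^×`, the boundary `∂A_A ⊆ ℂ^×` of the angular region of an object of `C π` ([FrdII] Def. 3.1
(iii), t4's `AngularRegion.boundary`), the map `ℂ^× → ℂ^×` underlying an arrow (data (c) of Ex. 3.3
(i): `z ↦ ι⁻¹(scalar · z^{deg_Fr})`, `ι` = the base arrow's Galois twist), the radial endomorphisms
(positive real scalar; the factor `ord(K^×)` of the canonical decomposition, Def. 3.1 (ii)), and — for the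
"model type" clauses — the model Frobenioids ([FrdI] Thm. 5.2, `ModelFrobenioid`, `ModelFrobenioid.toElem`,
seat abc-iut-L1-t2) of the data `Φ^fld → Φ^gp` (Thm. 3.6 (i), `Λ = ℤ`) and `Φ^∡ → 0^gp` (Thm. 3.6
(ii)), with `Φ^fld`, `Φ^∡` from `ArchimedeanUnitMonoids.lean`.

NOT instantiated here (kept generic in the statement files, with the reason): Thm. 3.6 (i) "model
type" for `Λ ∈ {ℚ, ℝ}` and "`(C^Λ)^un-tr ⥲ C^ℝ`" (the map `(Φ^fld)^Λ → (Φ^Λ)^gp` and the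
unit-trivialisation are not constructible over the interface monoids of `LambdaCompletion`); Thm. 3.6
(iii) "determines an equivalence `C ⥲ A ×_{A^istr} C^istr`" (the isometrization / isotropification
functors, [FrdI] Prop. 1.9 (v), are not yet in the tree); the §2–§4-vocabulary clauses of
`ArchimedeanStandardType.lean` (birationalization / unit-trivialisation data of `C`). Every declaration
is a `Prop` (the printed claim at the Example 3.3 data); nothing is asserted; typed ≠ proved.

DISCHARGED so far (separate proof files of seat abc-iut-L1-t9, each PROVED unconditionally over any base
`π`): Thm. 3.6 (i) first clauses for `C^ℤ` (`thm36i_istrTypes_C'`, `ArchimedeanIstrProofs.lean`);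
(iii) factorization for `C` (`thm36iii_factorization_C`, `ArchimedeanIsometrization.lean`); (iv)
sentence 2 readings on `C₀` (`ArchimedeanAutActionWitness.lean`); (v) "`O^×(A) ≅ S¹`" for `C^ℤ`
(`thm36v_isoCircle_C`, `ArchimedeanUnitCircle.lean`); (vi) for `C` and `A` (`thm36vi_C`, `thm36vi_A`,
`ArchimedeanPseudoTerminal.lean`).
-/

namespace Literature.AlgebraicGeometry.Frobenioids

open CategoryTheory

universe v u

namespace ArchFrd

variable {D : Type u} [Category.{v} D] (π : D ⥤ D0) (pf rlf : LambdaCompletion π)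

/-- The base `D → D₀` read in t4's non-skeletal model `ArchBase = FinEtale ℝ` through the comparison
functor `D0.toArchBase` (on which [FrdII] Def. 3.1 (v), `RC.*`, is typed).
[cite: MochizukiFrdII2008, Def 3.1 (v) p.24] -/
noncomputable abbrev baseRC : D ⥤ ArchBase := π ⋙ D0.toArchBase

/-! ### The extra structure of Example 3.3 used by Thm. 3.6 (i)–(iii), (vii) -/

/-- The ambient space `V_A^× = ℂ^×` of the angular region of an object of `C` (Ex. 3.3 (i): `V_K := K`
read inside `ℂ`). [cite: MochizukiFrdII2008, Ex 3.3 (i) p.27] -/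
abbrev ambient (_A : C π) : Type := ℂˣ

/-- `∂A_A ⊆ ℂ^×`, the boundary of the angular region of an object of `C` ([FrdII] Def. 3.1 (iii)).
[cite: MochizukiFrdII2008, Def 3.1 (iii) p.24] -/
def bd (A : C π) : Set ℂˣ := A.fst.region.boundary

/-- The map `V_B^× → V_A^×` underlying an arrow `φ : B → A` of `C`: `z ↦ ι⁻¹(scalar(φ) · z^{deg_Fr φ})`
(data (c) of Ex. 3.3 (i); `ι` = the field embedding = the Galois action of the base arrow's twist, an
involution). [cite: MochizukiFrdII2008, Ex 3.3 (i) p.27] -/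
noncomputable def vMap ⦃B A : C π⦄ (φ : B ⟶ A) (z : ℂˣ) : ℂˣ :=
  D0.galAct (D0.Hom.twists (C0.Base φ.fst)) (C0.scalar φ.fst * z ^ (C0.degFr φ.fst : ℕ))

/-- The radial endomorphisms of an object of `C`: scalar (data (c)) a positive real number — the factor
`ord(K^×) ≅ ℝ_{>0}` of the canonical decomposition of [FrdII] Def. 3.1 (ii), i.e. the submonoid
`Φ^gp(A) × {1} ⊆ Φ^fld(A)` of Thm. 3.6 (iii). [cite: MochizukiFrdII2008, Thm 3.6 (iii) p.37] -/
def radial (A : C π) (f : A ⟶ A) : Prop :=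
  ((C0.scalar f.fst : ℂˣ) : ℂ).im = 0 ∧ 0 < ((C0.scalar f.fst : ℂˣ) : ℂ).re

/-- The same boundary data for the angular Frobenioid `A ⊆ C` (a wide subcategory).
[cite: MochizukiFrdII2008, Def 3.1 (iii) p.24] -/
def bdA (X : A π) : Set ℂˣ := bd π X.obj

/-- The underlying maps for arrows of `A ⊆ C`. [cite: MochizukiFrdII2008, Ex 3.3 (i) p.27] -/
noncomputable def vMapA ⦃Y X : A π⦄ (φ : Y ⟶ X) (z : ℂˣ) : ℂˣ := vMap π φ.1 z

/-- The datum `Φ^fld → Φ^gp` of Thm. 3.6 (i) (`Λ = ℤ`): the model Frobenioid ([FrdI] Thm. 5.2) of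
`(Φ, Φ^fld, pr₁)`. [cite: MochizukiFrdII2008, Thm 3.6 (i) p.36] -/
noncomputable abbrev fieldModel : Type u :=
  ModelFrobenioid (Φ π) (fieldMonoid (Φ π) π) (fieldMonoidToGp (Φ π) π)

/-- The zero map `Φ^∡ → 0^gp`, the datum of the model Frobenioid of Thm. 3.6 (ii) (the angular Frobenioid
is of group-like type: its divisor monoid is `0`). [cite: MochizukiFrdII2008, Thm 3.6 (ii) p.37] -/
noncomputable def unitMonoidDivZero : unitMonoid π ⟶ monoidGp (zeroMonoid D : Dᵒᵖ ⥤ CommMonCat.{0}) where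
  app _ := CommMonCat.ofHom 1
  naturality X Y f := by
    apply CommMonCat.hom_ext
    apply MonoidHom.ext
    intro x
    change (1 : (unitMonoid π).obj Y →* (monoidGp (zeroMonoid D : Dᵒᵖ ⥤ CommMonCat.{0})).obj Y)
        (((unitMonoid π).map f).hom x) =
      ((monoidGp (zeroMonoid D : Dᵒᵖ ⥤ CommMonCat.{0})).map f).hom
        ((1 : (unitMonoid π).obj X →* (monoidGp (zeroMonoid D : Dᵒᵖ ⥤ CommMonCat.{0})).obj X) x)
    rw [MonoidHom.one_apply, MonoidHom.one_apply, map_one]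

/-- The model Frobenioid of the datum `(0, Φ^∡, 0)` (Thm. 3.6 (ii)). [cite: MochizukiFrdII2008, Thm 3.6 (ii) p.37] -/
noncomputable abbrev unitModel : Type u :=
  ModelFrobenioid (zeroMonoid D : Dᵒᵖ ⥤ CommMonCat.{0}) (unitMonoid π) (unitMonoidDivZero π)

/-! ### Proposition 3.5 at `C`, `A`, `N`, `R` -/

/-- **Prop. 3.5 (i)** for `H = C`. [cite: MochizukiFrdII2008, Prop 3.5 (i) p.34] -/
def Prop35i_C : Prop := Prop35i (baseRC π) (C.toElem π) (𝟭 (C π))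

/-- **Prop. 3.5 (i)** for `H = A` (pull-back morphisms of the Frobenioid `A` itself).
[cite: MochizukiFrdII2008, Prop 3.5 (i) p.34] -/
def Prop35i_A : Prop := Prop35i (baseRC π) (A.toElem π) (𝟭 (A π))

/-- **Prop. 3.5 (i)** for `H = N` (terminology via `N → C`). [cite: MochizukiFrdII2008, Prop 3.5 (i) p.34] -/
def Prop35i_N : Prop := Prop35i (baseRC π) (C.toElem π) (N.toC π)

/-- **Prop. 3.5 (i)** for `H = R` (terminology via `R → C`). [cite: MochizukiFrdII2008, Prop 3.5 (i) p.34] -/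
def Prop35i_R : Prop := Prop35i (baseRC π) (C.toElem π) (R.toC π)

/-- **Prop. 3.5 (ii)** for `F = C`. [cite: MochizukiFrdII2008, Prop 3.5 (ii) p.34] -/
def Prop35ii_C : Prop := Prop35ii (baseRC π) (C.toElem π)

/-- **Prop. 3.5 (ii)** for `F = A`. [cite: MochizukiFrdII2008, Prop 3.5 (ii) p.34] -/
def Prop35ii_A : Prop := Prop35ii (baseRC π) (A.toElem π)

/-- **Prop. 3.5 (iii)** for `G = N`. [cite: MochizukiFrdII2008, Prop 3.5 (iii) p.34] -/
def Prop35iii_N : Prop := Prop35iii (baseRC π) (C.toElem π) (N.toC π)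

/-- **Prop. 3.5 (iii)** for `G = R`. [cite: MochizukiFrdII2008, Prop 3.5 (iii) p.34] -/
def Prop35iii_R : Prop := Prop35iii (baseRC π) (C.toElem π) (R.toC π)

/-- **Prop. 3.5 (iv)** for `F = C`. [cite: MochizukiFrdII2008, Prop 3.5 (iv) p.34] -/
def Prop35iv_C : Prop := Prop35iv (baseRC π) (C.toElem π)

/-- **Prop. 3.5 (iv)** for `F = A`. [cite: MochizukiFrdII2008, Prop 3.5 (iv) p.34] -/
def Prop35iv_A : Prop := Prop35iv (baseRC π) (A.toElem π)

/-! ### Theorem 3.6 at `C^Λ` and `A` -/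

/-- **Thm. 3.6 (i)**, "`(C^Λ)^istr` is of isotropic, base-trivial type", all `Λ`.
[cite: MochizukiFrdII2008, Thm 3.6 (i) p.36] -/
def Thm36i_istrTypes_C : Prop := ∀ Λ : MonoidType, Thm36i_istrTypes (archFrobenioid π pf rlf Λ).str

/-- **Thm. 3.6 (i)**, "`(C^Λ)^istr` is of model type, with rational function monoid `(Φ^fld)^Λ`", the case
`Λ = ℤ`: `C^istr` is equivalent over `F_Φ` to the model Frobenioid of `Φ^fld → Φ^gp`.
[cite: MochizukiFrdII2008, Thm 3.6 (i) p.36] -/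
def Thm36i_istrModel_C : Prop :=
  Thm36i_istrModel (C.toElem π)
    (ModelFrobenioid.toElem (Φ π) (fieldMonoid (Φ π) π) (fieldMonoidToGp (Φ π) π))

/-- **Thm. 3.6 (i)**, "If `Λ ≥ ℚ`, then `(C^Λ)^istr = C^Λ`". [cite: MochizukiFrdII2008, Thm 3.6 (i) p.36] -/
def Thm36i_istr_all_C : Prop := ∀ Λ : MonoidType, Thm36i_istr_all (archFrobenioid π pf rlf Λ).str Λ

/-- **Thm. 3.6 (i)**, "`C^Λ` is of `Aut`-ample, `Aut^sub`-ample, `End`-ample and metrically trivial type,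
but not of group-like type", all `Λ`. [cite: MochizukiFrdII2008, Thm 3.6 (i) p.36] -/
def Thm36i_ampleTypes_C : Prop := ∀ Λ : MonoidType, Thm36i_ampleTypes (archFrobenioid π pf rlf Λ).str

/-- **Thm. 3.6 (ii)**, "`A^istr` is of base-trivial type". [cite: MochizukiFrdII2008, Thm 3.6 (ii) p.37] -/
def Thm36ii_istrBaseTrivial_A : Prop := Thm36ii_istrBaseTrivial (A.toElem π)

/-- **Thm. 3.6 (ii)**, "`A^istr` is of model type, with rational function monoid `Φ^∡`": `A^istr` is
equivalent over `F_0` to the model Frobenioid of `Φ^∡ → 0`. [cite: MochizukiFrdII2008, Thm 3.6 (ii) p.37] -/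
def Thm36ii_istrModel_A : Prop :=
  Thm36ii_istrModel (A.toElem π)
    (ModelFrobenioid.toElem (zeroMonoid D : Dᵒᵖ ⥤ CommMonCat.{0}) (unitMonoid π) (unitMonoidDivZero π))

/-- **Thm. 3.6 (ii)**, "`A` is of `Aut`-ample, `Aut^sub`-ample, `End`-ample, group-like and metrically
trivial type". [cite: MochizukiFrdII2008, Thm 3.6 (ii) p.37] -/
def Thm36ii_ampleTypes_A : Prop := Thm36ii_ampleTypes (A.toElem π)

/-- **Thm. 3.6 (iii)**, the factorization `φ = β ∘ α` (isometry, then radial element of `O^▷(A)`), for `C`.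
[cite: MochizukiFrdII2008, Thm 3.6 (iii) p.37] -/
def Thm36iii_factorization_C : Prop := Thm36iii_factorization (C.toElem π) (radial π)

/-- **Thm. 3.6 (iv)**, FIRST sentence, for `C^Λ` (all `Λ`): the action of `Aut(A)` on `O^▷(A), O^×(A)`
factors through `Aut_{D₀}(A₀)`. The SECOND sentence is flag register L1 #6 (FALSE as printed at `Λ = ℤ`
for complex non-isotropic objects, referee ref-a A8-F3; kernel witness `ArchFrd.C0.not_thm36iv_faithful_C0`):
by layer ruling P1 it is NOT instantiated as a bare statement; its repaired readings are
`Thm36iv_readings_CA` below. [cite: MochizukiFrdII2008, Thm 3.6 (iv) p.37] -/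
def Thm36iv_C : Prop := ∀ Λ : MonoidType, Thm36iv_factors (baseRC π) (archFrobenioid π pf rlf Λ).str

/-- **Thm. 3.6 (iv)**, FIRST sentence, for `A` (second sentence: see `Thm36iv_C`, `Thm36iv_readings_CA`).
[cite: MochizukiFrdII2008, Thm 3.6 (iv) p.37] -/
def Thm36iv_A : Prop := Thm36iv_factors (baseRC π) (A.toElem π)

/-- The candidate repaired readings of **Thm. 3.6 (iv)**, second sentence (layer-lead ruling
2026-08-25T19:26:58Z), for `C^Λ` and `A`. [cite: MochizukiFrdII2008, Thm 3.6 (iv) p.37] -/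
def Thm36iv_readings_CA : Prop :=
  (∀ Λ : MonoidType, Thm36iv_faithful_of_isIsotropic (baseRC π) (archFrobenioid π pf rlf Λ).str Λ ∧
      Thm36iv_faithful_istr (baseRC π) (archFrobenioid π pf rlf Λ).str Λ) ∧
    Thm36iv_faithful_of_isIsotropic (baseRC π) (A.toElem π) .Z ∧
    Thm36iv_faithful_istr (baseRC π) (A.toElem π) .Z

/-- **Thm. 3.6 (v)** for `C^Λ` (all clauses, all `Λ`). [cite: MochizukiFrdII2008, Thm 3.6 (v) p.37] -/
def Thm36v_C : Prop :=
  ∀ Λ : MonoidType,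
    Thm36v_trivial (baseRC π) (archFrobenioid π pf rlf Λ).str Λ ∧
      Thm36v_torsionFree (baseRC π) (archFrobenioid π pf rlf Λ).str Λ ∧
      Thm36v_isoCircleTensorRat (baseRC π) (archFrobenioid π pf rlf Λ).str Λ ∧
      Thm36v_orderTwo (baseRC π) (archFrobenioid π pf rlf Λ).str Λ ∧
      Thm36v_torsion (baseRC π) (archFrobenioid π pf rlf Λ).str Λ ∧
      Thm36v_isoCircle (baseRC π) (archFrobenioid π pf rlf Λ).str Λ

/-- **Thm. 3.6 (v)** for `A` (`Λ = ℤ`; all clauses). [cite: MochizukiFrdII2008, Thm 3.6 (v) p.37] -/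
def Thm36v_A : Prop :=
  Thm36v_trivial (baseRC π) (A.toElem π) .Z ∧ Thm36v_torsionFree (baseRC π) (A.toElem π) .Z ∧
    Thm36v_isoCircleTensorRat (baseRC π) (A.toElem π) .Z ∧ Thm36v_orderTwo (baseRC π) (A.toElem π) .Z ∧
    Thm36v_torsion (baseRC π) (A.toElem π) .Z ∧ Thm36v_isoCircle (baseRC π) (A.toElem π) .Z

/-- **Thm. 3.6 (vi)** for `C^Λ` (all `Λ`) and `A`. [cite: MochizukiFrdII2008, Thm 3.6 (vi) p.37] -/
def Thm36vi_CA : Prop :=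
  (∀ Λ : MonoidType, Thm36vi D (archFrobenioid π pf rlf Λ).cat) ∧ Thm36vi D (A π)

/-- **Thm. 3.6 (vii)** for `C` (`Λ = ℤ`): equivalence `C^imtr-pre_A ⥲ Open⁰(∂A_A)`, recovery of `∂A_A`,
torsor structure. [cite: MochizukiFrdII2008, Thm 3.6 (vii) p.37] -/
def Thm36vii_C : Prop :=
  Thm36vii_equiv (baseRC π) (C.toElem π) .Z (ambient π) (bd π) (vMap π) ∧
    Thm36vii_recover (baseRC π) (C.toElem π) .Z (ambient π) (bd π) ∧
    Thm36vii_torsor (baseRC π) (C.toElem π) .Z (ambient π) (bd π) (vMap π)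

/-- **Thm. 3.6 (vii)** for `A` (`Λ = ℤ`). [cite: MochizukiFrdII2008, Thm 3.6 (vii) p.37] -/
def Thm36vii_A : Prop :=
  Thm36vii_equiv (baseRC π) (A.toElem π) .Z (fun X => ambient π X.obj) (bdA π) (vMapA π) ∧
    Thm36vii_recover (baseRC π) (A.toElem π) .Z (fun X => ambient π X.obj) (bdA π) ∧
    Thm36vii_torsor (baseRC π) (A.toElem π) .Z (fun X => ambient π X.obj) (bdA π) (vMapA π)

/-- **Thm. 3.6 (viii)** for `C^Λ` and `A`. [cite: MochizukiFrdII2008, Thm 3.6 (viii) p.38] -/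
def Thm36viii_CA : Prop :=
  (∀ Λ : MonoidType, Thm36viii (baseRC π) (archFrobenioid π pf rlf Λ).str Λ) ∧
    Thm36viii (baseRC π) (A.toElem π) .Z

/-- **Thm. 3.6 (ix)** for `C^Λ` and `A`. [cite: MochizukiFrdII2008, Thm 3.6 (ix) p.38] -/
def Thm36ix_CA : Prop :=
  (∀ Λ : MonoidType, Thm36ix (baseRC π) (archFrobenioid π pf rlf Λ).str Λ) ∧
    Thm36ix (baseRC π) (A.toElem π) .Z

/-- **Thm. 3.6 (x)** for `C^Λ` and `A`. [cite: MochizukiFrdII2008, Thm 3.6 (x) p.38] -/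
def Thm36x_CA : Prop :=
  (∀ Λ : MonoidType, Thm36x Λ D (archFrobenioid π pf rlf Λ).cat) ∧ Thm36x MonoidType.Z D (A π)

/-- **Remark 3.6.1** for `C`. [cite: MochizukiFrdII2008, Rmk 3.6.1 p.39] -/
def Rmk361_C : Prop := Rmk361 (baseRC π) (C.toElem π) .Z (ambient π) (bd π) (vMap π)

end ArchFrd

end Literature.AlgebraicGeometry.Frobenioids
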